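import Summits.Ventures.CertifiedManyBodySolver.Rows.CorrWindowCertKernelChainForest
import HarnessLib

/-!
# The chain forest with a MERGE TREE: the P segment ends merged along ANY schedule (certificate `MergesTo`), so that segments can be
# as short as ONE chain file and every chain file imports only the head — the forest's build-window depth no longer grows with files/segment

HONEST FRAMING (xx1): Lean plumbing towards «tier P». The landed forest (`Rows/CorrWindowCertKernelChainForest.lean`, p689933) merges the
segment ends by ONE right fold `hfin : Cfin = mergeAllE Bkey (ends segs)` — one `decide` of cost ≈ P × |C_fin|, which bounds P. Here the merge is a
CERTIFICATE `MergesTo B L C` (an inductive Prop: leaves, and binary nodes carrying the kernel fact `M = mergeE B C₁ C₂`; `MergesTo.joinAll`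
builds an n-ary node from `M = mergeAllE B Cs`), with `MergesTo.evalPoly_eq : evalPoly d (decPoly N C) = (L.map …).sum`; the two closers of the
forest file are re-stated with `(hfin : MergesTo Bkey (ends segs) Cfin)` in place of the fold equation — proofs otherwise VERBATIM (one `rw`
changes). An emitter can then cut P = one segment per chain file (each imports Head + its Hints only) and merge the ends in a 2-level tree of
small `eval%` + `decide` files. Nothing of record moves; no certificate evaluated; no claim node discharged; CONTROL/CALIBRATION context; silent on
the presence of superconductivity; not a `T_c` or phase sentence; nothing about any material; no summit statement is proved by this file.
Cell `hubbard-obs` × `hubbard-downfold` (D-0154 (1)(C) La214), seat hubbard-cov-la214-box-2 g5 (`prover-hubbard-cov-la214-box-2-g5-0`), typed in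
folder as a design note for captain ruling R-g4-14 (build-window wall model); zero compute.

References: C. Jansson, D. Chaykin, C. Keil, SIAM J. Numer. Anal. 46 (2008) 180 [JanssonChaykinKeil2008]; X. Han, arXiv:2006.06002 §3
[Han2020Bootstrap]; J. Wang et al., PRX 14 (2024) 031006 §III [WangEtAl2024].
-/

namespace Summit.Ventures.CertifiedManyBodySolver

namespace CARPolyWindow

open Summit.Ventures.CertifiedQuantumChemistry Summit.Ventures.CertifiedQuantumChemistry.CARPoly
open Literature.MathematicalPhysics.QuantumLattice Literature.MathematicalPhysics.QuantumLattice.HubbardWave0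
open Literature.MathematicalPhysics.QuantumManyBody.StateRelaxation
open Literature.Probability.LatticeModels ThermodynamicLimit Filter Topology
open Matrix BoxGeom
open scoped ComplexOrder BigOperators

/-! ## §1 The merge certificate -/

section MergeTree

variable {N : ℕ}

/-- **A merge certificate**: `MergesTo B L C` says the encoded polynomial `C` was obtained from the list `L` by `mergeE` steps in SOME
parenthesisation (leaf: a list of one is its element; node: two certified merges glued by one kernel fact `M = mergeE B C₁ C₂`).
[cite: JanssonChaykinKeil2008, §3] -/
inductive MergesTo (B : ℕ) : List SOSDual.EncPoly → SOSDual.EncPoly → Prop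
  | nil : MergesTo B [] []
  | leaf (C : SOSDual.EncPoly) : MergesTo B [C] C
  | node {L₁ L₂ : List SOSDual.EncPoly} {C₁ C₂ M : SOSDual.EncPoly} (h₁ : MergesTo B L₁ C₁) (h₂ : MergesTo B L₂ C₂)
      (hM : M = SOSDual.mergeE B C₁ C₂) : MergesTo B (L₁ ++ L₂) M

/-- **An n-ary node from ONE `mergeAllE` fact** (what a merge file states: `M := eval% mergeAllE B [C₁, …, C_k]`,
`hM : M = mergeAllE B [C₁, …, C_k] := eq_of_beq (by decide +kernel)`, children certified). [folklore] -/
theorem MergesTo.joinAll {B : ℕ} : ∀ {Ls : List (List SOSDual.EncPoly)} {Cs : List SOSDual.EncPoly},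
    List.Forall₂ (MergesTo B) Ls Cs → ∀ {M : SOSDual.EncPoly}, M = mergeAllE B Cs → MergesTo B Ls.flatten M
  | _, _, List.Forall₂.nil, M, hM => by rw [List.flatten_nil, hM, mergeAllE]; exact MergesTo.nil
  | _, _, List.Forall₂.cons (a := L) (b := C) h hs, M, hM => by
    rw [List.flatten_cons]
    exact MergesTo.node h (MergesTo.joinAll hs rfl) (by rw [hM, mergeAllE])

/-- The right fold of record is a certificate (so the tree closers subsume the forest closers). [folklore] -/
theorem MergesTo.ofMergeAllE {B : ℕ} : ∀ (Cs : List SOSDual.EncPoly) {M : SOSDual.EncPoly}, M = mergeAllE B Cs → MergesTo B Cs M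
  | [], M, hM => by rw [hM, mergeAllE]; exact MergesTo.nil
  | C :: Cs, M, hM => by
    rw [← List.singleton_append]
    exact MergesTo.node (MergesTo.leaf C) (MergesTo.ofMergeAllE Cs rfl) (by rw [hM, mergeAllE])

variable [NeZero N] {ι : Type*} [LinearOrder ι] [Fintype ι]

/-- **A certified merge denotes the SUM.** [folklore] -/
theorem MergesTo.evalPoly_eq (d : Orb (Fin N) → ι) {B : ℕ} {L : List SOSDual.EncPoly} {C : SOSDual.EncPoly} (h : MergesTo B L C) :
    evalPoly d (SOSDual.decPoly N C) = (L.map fun X => evalPoly d (SOSDual.decPoly N X)).sum := by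
  induction h with
  | nil => rw [evalPoly_decPoly_nil, List.map_nil, List.sum_nil]
  | leaf C => rw [List.map_singleton, List.sum_singleton]
  | node h₁ h₂ hM ih₁ ih₂ => rw [hM, evalPoly_decPoly_mergeE', ih₁, ih₂, List.map_append, List.sum_append]

end MergeTree

/-! ## §2 The closers with a merge certificate (proofs = the forest closers' with one rewrite changed) -/

noncomputable section ForestTreeClosers

variable {N Nβ : ℕ} [NeZero N]

/-- **CLOSER, CHAIN FOREST WITH MERGE TREE, ABSTRACT GRAM WITH ANTI-HERMITIAN REMAINDER, KERNEL EOM MASKS** — as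
`affineOrbitLowerRowN_of_quotAdjForestKernelCertGXAuto` with `(hfin : MergesTo Bkey (ends segs) Cfin)`. [cite: WangEtAl2024, §III]
[cite: Han2020Bootstrap, §3] [cite: JanssonChaykinKeil2008, §3] -/
theorem affineOrbitLowerRowN_of_quotAdjForestTreeKernelCertGXAuto
    (tp U : ℚ) (hU : 0 ≤ U)
    {Λ Λ' : Finset (Site 2)} (hΛ : Λ ⊆ Λ') (h8 : thicken Λ 1 ⊆ Λ')
    (h0 : thicken ({0} : Finset (Site 2)) 1 ⊆ Λ') (hz : (0 : Site 2) ∈ Λ')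
    {S : Finset (DihedralGroup 4)} (h1 : (1 : DihedralGroup 4) ∈ S) (hmul : ∀ a ∈ S, ∀ b ∈ S, a * b ∈ S)
    (D : QuotData N Nβ) (hxs : ∀ i, D.xs i ∈ Λ') (hix : ∀ y ∈ Λ', D.xs (D.ix y) = y)
    (hxsβ : ∀ j, D.xsβ j ∈ Λ) (hcovβ : ∀ x ∈ Λ, ∃ j, D.xsβ j = x)
    (d : Orb (Fin N) → Orb (PolySite Λ')) (hd : Function.Injective d)
    (hdx : ∀ i σ, d (orb i σ) = orb (PolySite.pt (D.xs i) (hxs i)) σ) (Bkey : ℕ)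
    (dΛ : Orb (Fin Nβ) → Orb (PolySite Λ)) (hdΛ : ∀ j σ, dΛ (orb j σ) = orb (PolySite.pt (D.xsβ j) (hxsβ j)) σ)
    (hf : ∀ b, d (D.f b) = Orb.embMap (PolySite.incl hΛ) (dΛ b))
    (sp : Orb (Fin N) → Fin 2) (hsp : ∀ a, (ofLex (d a)).2 = sp a)
    (hokS : ∀ γc v, D.ok γc v = true → d4OfCode γc ∈ S)
    (hokV : ∀ γc v, D.ok γc v = true →
      ∀ j : Fin Nβ, D.xs (D.ix (d4Vec (d4OfCode γc) (D.xsβ j) + siteOfPair v)) = d4Vec (d4OfCode γc) (D.xsβ j) + siteOfPair v)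
    (TH : Terms (Orb (Fin N))) (hH : termOp d TH = (hubbardTTPrimeFermionInteraction 1 tp U).localHamiltonian Λ')
    (TE : Terms (Orb (Fin N)))
    (hE : termOp d TE = fermionEmbed (PolySite.incl h0) ((hubbardTTPrimeFermionInteraction 1 tp U).meanEnergyObs 1))
    (o : Fin 2 → Orb (Fin N)) (ho : ∀ σ, d (o σ) = orb (PolySite.pt 0 hz) σ)
    (TX : Terms (Orb (Fin N))) (μ : Fin 2 → ℚ) (ν κhi hi κlo lo : ℚ)
    (TGs : List (Terms (Orb (Fin N)))) (TGf V : Terms (Orb (Fin N)))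
    {m : Type*} [Fintype m] [DecidableEq m] {Λm : Matrix m m ℂ} (hΛm : Λm.PosSemidef)
    (O : m → FermionOp Λ') (hTGf : termOp d TGf = gramForm Λm O)
    (hX : termOp d TGs.flatten = termOp d TGf - termOp d V + (termOp d V)ᴴ)
    (EB : List (Terms (Orb (Fin Nβ))))
    (CW : Terms (Orb (Fin N))) (hcw : ∀ wc ∈ CW, chargeW wc.1 ≠ 0 ∨ spinChargeW sp wc.1 ≠ 0)
    (AV : List (Terms (Orb (Fin N))))
    -- the forest
    (ns : List ℕ) (Hs : List (List (QHint Nβ))) (segs : List Seg)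
    (hforest : ForestFrom D Bkey
      (groupSlices (residTGslicesNear TX μ ν o κhi hi κlo lo TE TGs TH D.f EB (autoMasks TH D.f EB)
        (fun l : Fin 0 => l.elim0) (fun l : Fin 0 => l.elim0) CW AV) ns) Hs 0 segs)
    (Cfin : SOSDual.EncPoly) (hfin : MergesTo Bkey (ends segs) Cfin)
    {q s n₀ : ℚ} (hs : s = (μ 0 + μ 1) / 2)
    (hq : q ≤ lowerConst (SOSDual.decPoly N Cfin) + (μ 0 + μ 1) * (n₀ / 2 - ν)) :
    SquareTTPrimeCorrAffineOrbitLowerRowN (tp : ℝ) (U : ℝ) q hi lo κhi κlo s n₀ S Λ' (termOp d TX) := by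
  set Ts := groupSlices (residTGslicesNear TX μ ν o κhi hi κlo lo TE TGs TH D.f EB (autoMasks TH D.f EB)
    (fun l : Fin 0 => l.elim0) (fun l : Fin 0 => l.elim0) CW AV) ns with hTs
  set L := forestMoves D Bkey Ts Hs 0 segs with hL
  set LA := forestAdj D Bkey Ts Hs 0 segs with hLA
  have hLok : ∀ mv ∈ L, D.ok mv.1 mv.2.1 = true := ok_of_mem_forestMoves D Bkey Ts Hs segs 0
  let γf : Fin L.length → DihedralGroup 4 := fun l => d4OfCode (L.get l).1
  let wvf : Fin L.length → Site 2 := fun l => siteOfPair (L.get l).2.1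
  let gf : Fin L.length → Orb (Fin Nβ) → Orb (Fin N) := fun l => gq D (γf l) (wvf l)
  let SYf : Fin L.length → Terms (Orb (Fin Nβ)) := fun l => (L.get l).2.2
  have hγS : ∀ l, γf l ∈ S := fun l => hokS _ _ (hLok _ (List.get_mem L l))
  have hsh : ∀ l, d4ShiftSet (γf l) (wvf l) Λ ⊆ Λ' := fun l =>
    shiftSet_subset_of_table D hxs hcovβ (γf l) (wvf l) (hokV _ _ (hLok _ (List.get_mem L l)))
  have hg : ∀ l b, d (gf l b) = Orb.embMap (PolySite.incl (hsh l)) (Orb.embMap (PolySite.d4Emb (γf l) (wvf l) Λ) (dΛ b)) :=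
    fun l b => by rw [← orb_ofLex_eq b]; exact d_gq D hxs d hdx hix hxsβ dΛ hdΛ (γf l) (wvf l) (hsh l) _ _
  -- the semantic residual hypothesis from the forest
  have hRsem : evalPoly d (SOSDual.decPoly N Cfin) =
      termOp d (residTG TX μ ν o κhi hi κlo lo TE TGs.flatten TH D.f EB gf SYf CW (AV ++ LA)) := by
    rw [hfin.evalPoly_eq d, evalPoly_forest hd D Bkey Ts Hs segs 0 hforest, List.drop_zero, hTs, flatten_groupSlices,
      termOp_flatten_residTGslicesNear_auto hd TX μ ν o κhi hi κlo lo TE _ TH D.f EB _ _ CW AV,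
      termOp_residTG_moves_adj d TX μ ν o κhi hi κlo lo TE _ TH D.f EB gf SYf CW AV LA, ← hTs, ← hL, ← hLA, termOp_symTL_eq]
  rw [termOp_residTG_gramX d TX μ ν o κhi hi κlo lo TE TGs.flatten TGf V hX TH D.f EB gf SYf CW (AV ++ LA)] at hRsem
  exact affineOrbitLowerRowN_of_residPolyG tp U hU hΛ h8 h0 hz h1 hmul d dΛ D.f hf sp hsp TH hH TE hE o ho TX μ ν κhi hi κlo lo
    TGf hΛm O hTGf EB γf hγS wvf hsh gf hg SYf CW hcw ((AV ++ LA) ++ [V]) hRsem hs hq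


/-- **CLOSER, CHAIN FOREST WITH MERGE TREE, SINGLE VERTEX AT BOX GEOMETRY, HALF-ROW GRAM** — as
`affineOrbitLowerRowN_of_forestTBRowsHalfAuto_box` with `(hfin : MergesTo Bkey (ends segs) Cfin)`. [cite: WangEtAl2024, §III]
[cite: Han2020Bootstrap, §3] [cite: JanssonChaykinKeil2008, §3] -/
theorem affineOrbitLowerRowN_of_forestTreeTBRowsHalfAuto_box (r R vmax : ℕ) (hrR : r + 1 ≤ R) (hv : r + vmax ≤ R)
    (tp U : ℚ) (hU : 0 ≤ U) (Bkey : ℕ)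
    (D : QuotData (boxN R) (boxN r)) (hD : D = boxQuot r R vmax)
    (TH : Terms (Orb (Fin (boxN R)))) (hTH : TH = hamTermsBox R 1 tp U)
    (TE : Terms (Orb (Fin (boxN R)))) (hTE : TE = energyTermsIdx 1 tp U (boxIx R))
    (o : Fin 2 → Orb (Fin (boxN R))) (ho : o = fun σ => orb (boxIx R 0) σ)
    (TX : Terms (Orb (Fin (boxN R)))) (μ : Fin 2 → ℚ) (ν κhi hi κlo lo : ℚ) (K : ℕ)
    (blocks : List (List (List ℤ × Terms (Orb (Fin (boxN R)))))) (EB : List (Terms (Orb (Fin (boxN r)))))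
    (CW : Terms (Orb (Fin (boxN R)))) (hcw : ∀ wc ∈ CW, chargeW wc.1 ≠ 0 ∨ spinChargeW (fun p => (ofLex p).2) wc.1 ≠ 0)
    (AV : List (Terms (Orb (Fin (boxN R)))))
    (ns : List ℕ) (Hs : List (List (QHint (boxN r)))) (segs : List Seg)
    (hforest : ForestFrom D Bkey
      (groupSlices (residTGslicesNear TX μ ν o κhi hi κlo lo TE (gramTBRowsHalf K blocks) TH D.f EB (autoMasks TH D.f EB)
        (fun l : Fin 0 => l.elim0) (fun l : Fin 0 => l.elim0) CW AV) ns) Hs 0 segs)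
    (Cfin : SOSDual.EncPoly) (hfin : MergesTo Bkey (ends segs) Cfin)
    {q s n₀ : ℚ} (hs : s = (μ 0 + μ 1) / 2)
    (hq : haveI := neZero_boxN R; q ≤ lowerConst (SOSDual.decPoly (boxN R) Cfin) + (μ 0 + μ 1) * (n₀ / 2 - ν)) :
    SquareTTPrimeCorrAffineOrbitLowerRowN (tp : ℝ) (U : ℝ) q hi lo κhi κlo s n₀ Finset.univ (boxW R) (termOp (boxD R) TX) := by
  haveI : NeZero (boxN R) := neZero_boxN R
  subst hD hTH hTE ho
  have hR : 1 ≤ R := le_trans (Nat.le_add_left 1 r) hrR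
  have hrle : r ≤ R := le_trans (Nat.le_succ r) hrR
  have hz : (0 : Site 2) ∈ boxW R := zero_mem_boxW R
  have h1 : (1 : DihedralGroup 4) ∈ (Finset.univ : Finset (DihedralGroup 4)) := Finset.mem_univ _
  have hmul : ∀ a ∈ (Finset.univ : Finset (DihedralGroup 4)), ∀ b ∈ (Finset.univ : Finset (DihedralGroup 4)),
      a * b ∈ (Finset.univ : Finset (DihedralGroup 4)) := fun _ _ _ _ => Finset.mem_univ _
  have hΛ : boxW r ⊆ boxW R := boxW_mono hrle
  have h8 : thicken (boxW r) 1 ⊆ boxW R := Summit.Ventures.CertifiedManyBodySolver.Downfold.thicken_boxW_subset_boxW hrR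
  have h0 : thicken ({0} : Finset (Site 2)) 1 ⊆ boxW R := Summit.Ventures.CertifiedManyBodySolver.Downfold.thicken01_subset_boxW hR
  have ho' : ∀ σ : Fin 2, boxD R ((fun σ => orb (boxIx R 0) σ) σ) = orb (PolySite.pt 0 hz) σ := fun σ =>
    Summit.Ventures.CertifiedManyBodySolver.Downfold.boxD_orb_boxIx_zero R σ
  have hix0 : ∀ v ∈ thicken ({0} : Finset (Site 2)) 1, boxXs R (boxIx R v) = v := fun v hv => boxXs_boxIx R v (h0 hv)
  have hokS : ∀ (γc : Fin 8) (v : ℤ × ℤ), (boxQuot r R vmax).ok γc v = true → d4OfCode γc ∈ (Finset.univ : Finset (DihedralGroup 4)) :=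
    fun _ _ _ => Finset.mem_univ _
  have hokV : ∀ (γc : Fin 8) (v : ℤ × ℤ), (boxQuot r R vmax).ok γc v = true → ∀ j : Fin (boxN r),
      (boxQuot r R vmax).xs ((boxQuot r R vmax).ix (d4Vec (d4OfCode γc) ((boxQuot r R vmax).xsβ j) + siteOfPair v)) =
        d4Vec (d4OfCode γc) ((boxQuot r R vmax).xsβ j) + siteOfPair v :=
    fun γc v h j => box_hokV hv γc v h j
  have hH : termOp (boxD R) (hamTermsBox R 1 tp U) = (hubbardTTPrimeFermionInteraction 1 (tp : ℝ) (U : ℝ)).localHamiltonian (boxW R) := by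
    rw [termOp_hamTermsBox, Rat.cast_one]
  have hE : termOp (boxD R) (energyTermsIdx 1 tp U (boxIx R)) =
      fermionEmbed (PolySite.incl h0) ((hubbardTTPrimeFermionInteraction 1 (tp : ℝ) (U : ℝ)).meanEnergyObs 1) := by
    have h := termOp_energyTermsIdx (N := boxN R) 1 tp U (boxXs R) (boxXs_mem R) h0 (boxIx R) hix0 (boxD R) (boxD_orb R)
    rw [Rat.cast_one] at h
    exact h
  exact affineOrbitLowerRowN_of_quotAdjForestTreeKernelCertGXAuto tp U hU hΛ h8 h0 hz h1 hmul (boxQuot r R vmax) (boxXs_mem R)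
    (boxXs_boxIx R) (boxXs_mem r) (boxQuot_hcovβ r R vmax) (boxD R) (boxD_injective R) (boxD_orb R) Bkey (boxD r) (boxQuot_hdΛ r R vmax)
    (boxD_boxPush hrle) (fun p => (ofLex p).2) (boxD_spin R) hokS hokV (hamTermsBox R 1 tp U) hH (energyTermsIdx 1 tp U (boxIx R)) hE
    (fun σ => orb (boxIx R 0) σ) ho' TX μ ν κhi hi κlo lo (gramTBRowsHalf K blocks) (gramTB K blocks) (lowerTB K blocks)
    (gramTBCoef_posSemidef K blocks) (gramTBOp (boxD R) blocks) (termOp_gramTB_eq_gramForm (boxD R) K blocks)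
    (termOp_flatten_gramTBRowsHalf (boxD R) K blocks) EB CW hcw AV ns Hs segs hforest Cfin hfin hs hq


end ForestTreeClosers

end CARPolyWindow

end Summit.Ventures.CertifiedManyBodySolver
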